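import Summits.QuantumFields.BalabanUV.T4Continuum.Support.SubstrateChartRealSlicePair

/-!
# SUBSTRATE — [dict] D-8 ∕ THE RELATED PAIR CHART: THE SECTION OF RECORD IS A RELATED PAIR (run A's factor = run B's tower below its top
# level), the related slices, and the REAL WINDOW their real diameters live in (substrate side of Q-NE23-W; NE5 owner g36 «FOR GEN 37+: fold
# substrate postings of the depth-`r` recursion chart ∕ `e` ∕ `emb` ∕ `ρ`», `HOME/CLAIMS.log` l.19246; INTENT l.19346)

Cell `pub-balaban`, SUBSTRATE cell, seat `b2b-balaban-substrate-p1` (gen 5).  Summits-side under the LEAN PLACEMENT RULE.  Follower of W-17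
`SubstrateChartRealSlicePair` (p228028) BY NAME (`pairPoint`, `sliceDisc₂`, `hslice_sliceDisc₂_each`; through it p225653 `sliceArg`∕`sliceDisc`∕`unitaryLev`∕
`skewLev`, p224186 `sectionOfRecord`∕`TwoRunChart`, p220490 `towerDataOf`, p217365 `siteIdx`, p217182 `DrivenRuns.iter_transportRaw`); nothing restated.

WHY.  g36-c `OutputRateComplexSliceEntrywise.weightedEntrywiseRate_complex_of_record` (p230570) takes `real := Set.range ρ` for a reading `ρ` of REAL
backgrounds and asks, per entry and chart point, a slice whose real diameter lies in `Set.range ρ`.  The pair packages L-E12∕b∕c (p228028∕p229325∕p230297)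
place the real diameter of `sliceDisc₂ D R⁰ A r` in `unitaryLev₂ D` — pairs whose two factors move INDEPENDENTLY (`A.1`, `A.2` free); no run-relating reading
covers such pairs (NE5 owner R52 (2): independent pairs are REFUSED as a socket).  The kinematics of record repairs this: by `DrivenRuns.iter_transportRaw`
run A's factor of `sectionOfRecord D ι U` IS run B's tower of record with its top level dropped — the two runs' level-`k` fine tori `Tor (fine (lev L k) (2L^m))`
are the SAME type.  Hence the recursion chart OF RECORD (R52 (1)) is the RELATED one: run-B coordinates `A` only, chart points `relPair D (expChartT _ R⁰ A)`, slices
`relPair ∘ sliceDisc _ R⁰ A r = sliceDisc₂ D (relPair D R⁰) (relPair D A) r` (L-E12∕b∕c fire BY NAME at related coordinates), real diameters in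
`relPair D '' realWindow _ R⁰ ϱ`, `ϱ ≥ (1 + r⁻¹)·‖A‖` (Q-NE23-W's margin made exact), `ρ := relPair D ∘ Subtype.val` on (a union of) such windows.

HONEST FRAMING: rung (B)+1 of the FINITE-VOLUME T⁴ programme — NOT infinite volume, NOT a mass gap, NOT Clay; spine PROVED 0∕9; NE5 NOT PRINTED ∕ NOT
proved.  Finite-dimensional chart GEOMETRY + index bookkeeping ([folklore]), 0 estimate.  §4's identity is a statement about the TYPING OF RECORD (R42: the
species are indexed by the common unit torus and the level `k`; `towerDataOf` = `(K−k)`-fold averages), NOT about print: on related pairs the two runs'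
level-`k ≤ K` covariance species with EQUAL letter families coincide, so there the W1-real socket carries (i) the letter mismatch between the runs and (ii)
run B's top level — the owner's ∕ rows' reading (Q-NE23-W), asserted by nobody here.  Which window the rows deliver `hreal` on, and its regularity letters,
are the rows'.  HONEST DEPENDENCY (cell line, verbatim): continuum YM on T⁴ ⇐ BetaPertH ∧ nine spine estimates (0/9 proved); BetaPertH ⇐ (D1) ∧ (D4) ∧
CAP+tail; G-an2-4 gates asym, D1 and NE2/3/4.

WHAT.
* §1 `resA D : TowerData (D.F.P (D.K+1)) o → TowerData (D.F.P D.K) o` (drop the top level), `relPair D R := (resA D R, R)`; `rfl` algebra: `resA_apply`,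
  `resA_add ∕ _smul ∕ _zero`, `norm_resA_le`, `resA_mem_unitaryLev ∕ _skewLev`, `relPair_mem_unitaryLev₂`, `resA_expChartT ∕ _expChartInvT`, `resA_sliceArg ∕ _sliceDisc`,
  `pairPoint_relPair`, `sliceDisc₂_relPair`, `depth_resA_le`.
* §2 `siteIdx_ladder` ∕ `siteIdx_symm_ladder` (the `ZMod.ringEquivCongr` coherence of the tower charts along the ladder), `towerDataOf_apply_of_eq` (the tower of
  record at a displayed V1 level), **`towerDataOf_transport`** (run A's tower of the transported field = `resA` of run B's tower), **`sectionOfRecord_eq_relPair`**.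
* §3 `realWindow P R⁰ ϱ := expChartT P R⁰ '' (skewLev ∩ closedBall 0 ϱ)` (`_mono`, `_subset_unitaryLev`, `self_mem_realWindow`), `sliceDisc_ofReal_mem_realWindow`,
  `range_relPair_restrict` (`Set.range (relPair D ∘ Subtype.val) = relPair D '' S` — g36-c's `real := Set.range ρ` form);
  **`hslice_related_each`** — the seven clauses of `operatorRate_complex_of_realSlice_each` ∕ g36-c's per-entry `hslice` along the related slice, with the THIRD
  clause sharpened to `γ x ∈ relPair D '' W` for any `W ⊇ realWindow _ R⁰ ((1 + r⁻¹)‖A‖)`; `hslice_related_each_unitaryLev₂` (L-E12's third clause recovered);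
  `realWindowOfRecord D ι ϱ := ⋃ U, realWindow _ (towerDataOf_B U) ϱ` and **`hslice_related_each_record`** (centre := run B's tower of record of `U`, run A's
  centre rewritten to `(sectionOfRecord D ι U).1` by §2, third clause in `relPair D '' realWindowOfRecord D ι ϱ`).
* §4 **`covAtTLev_resA`** (levels `k ≤ K`: the two runs' level-lettered covariance species agree on related data; `covAtTLev_resA_top`: above `K` run A reads
  `0`); at the record: **`covAtOfRecord_transport`** ∕ `covAtOfRecord_carriers_transport` (run A's covariance OF RECORD at the transported field = run B's at
  the field, levels `≤ K`, for ONE `(c, a, s)` — which `slotsOfRecord` feeds to BOTH runs — and one contour family `Γ` at aligned levels; Q-S17, cov species).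
-/

noncomputable section

open scoped BigOperators ComplexConjugate Matrix Matrix.Norms.L2Operator Kronecker ComplexOrder
open Complex (I)

namespace Summit.QuantumFields.BalabanUV.T4Continuum.SubstrateChartRelatedPair

open Literature.MathematicalPhysics.QuantumFieldTheory.Balaban1983to89
open Literature.MathematicalPhysics.QuantumFieldTheory.Balaban1983to89.T4Continuum (T4Family)
open Literature.MathematicalPhysics.QuantumFieldTheory.Balaban1983to89.T4LevelShift (siteShift siteShift_apply coordEquiv_val ladderShift ladderShift_eq
  fieldShift_apply bondShift sitesPerDir_ladder)
open Literature.MathematicalPhysics.QuantumFieldTheory.Balaban1983to89.B5Prop11Plancherel (Tor fine)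
open Literature.MathematicalPhysics.QuantumFieldTheory.Balaban1983to89.B5G183RateUnitTower (lev lev_neZero)
open Summit.QuantumFields.BalabanUV.T4Continuum
open Summit.QuantumFields.BalabanUV.T4Continuum.B13Carriers (transportRaw TwoRuns.carriers_transport_val)
open Summit.QuantumFields.BalabanUV.T4Continuum.CovariantBlockAveraging (ContourSystem)
open Summit.QuantumFields.BalabanUV.T4Continuum.SubstrateBackgroundTransporters (unitMod siteIdx siteIdx_apply sitesPerDir_eq_fine transV_apply)
open Summit.QuantumFields.BalabanUV.T4Continuum.SubstrateTransporterSpecies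
open Summit.QuantumFields.BalabanUV.T4Continuum.SubstrateTransporterSpeciesHolo (expChartT expChartInvT expChartT_apply expChartT_zero)
open Summit.QuantumFields.BalabanUV.T4Continuum.SubstrateTransporterSpeciesLev (covAtTLev covAtTLev_apply)
open Summit.QuantumFields.BalabanUV.T4Continuum.SubstrateChartSection (sectionOfRecord sectionOfRecord_fst sectionOfRecord_snd TwoRunChart)
open Summit.QuantumFields.BalabanUV.T4Continuum.SubstrateChartRealSlice (unitaryLev skewLev sliceArg sliceDisc expChartT_mem_unitaryLev
  sliceArg_ofReal_mem_skewLev norm_sliceArg_le diffContOnCl_comp_sliceArg norm_comp_sliceArg_le norm_I_mul_ofReal unitaryLev₂ towerDataOf_mem_unitaryLev)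
open Summit.QuantumFields.BalabanUV.T4Continuum.SubstrateChartRealSlicePair (pairPoint sliceDisc₂ sliceDisc₂_I_mul)
open Summit.QuantumFields.BalabanUV.T4Continuum.SubstrateTwoRunsDriven (DrivenRuns)

variable {G : Type} [GaugeGroup G] (D : DrivenRuns G) {o : Type} [Fintype o] [DecidableEq o]

/-! ## §1 Dropping run B's top level; the related pair -/

/-- [folklore] The level index of run A read as a level index of run B (`k ≤ K < K + 1`). -/
theorem lt_levels_succ (k : Fin ((D.F.P D.K).K + 1)) : k.1 < (D.F.P (D.K + 1)).K + 1 := by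
  have := k.2; simp only [T4Family.P_K] at this ⊢; omega

/-- [folklore] **DROP THE TOP LEVEL** — the restriction of run B's tower (levels `0 … K+1` of the `(K+1)`-st torus) to run A's levels `≤ K` (the two runs'
level-`k` fine tori `Tor (fine (lev L k) (2L^m))` are the same type, so the restriction IS a run-A tower; no `cast`). -/
def resA (R : TowerData (D.F.P (D.K + 1)) o) : TowerData (D.F.P D.K) o := fun k ν x => R ⟨k.1, lt_levels_succ D k⟩ ν x

/-- [folklore] **THE RELATED PAIR** `(resA D R, R) : TwoRunChart D o` of a run-B tower `R` (run A's factor := `R` below its top level). -/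
def relPair (R : TowerData (D.F.P (D.K + 1)) o) : TwoRunChart D o := (resA D R, R)

omit [Fintype o] [DecidableEq o] in
/-- [folklore] `resA` unfolds. -/
@[simp] theorem resA_apply (R : TowerData (D.F.P (D.K + 1)) o) (k : Fin ((D.F.P D.K).K + 1)) (ν : Fin (D.F.P D.K).d)
    (x : Tor (fine (lev (D.F.P D.K).L k) (unitMod (D.F.P D.K))) × Fin (D.F.P D.K).d) :
    resA D R k ν x = R ⟨k.1, lt_levels_succ D k⟩ ν x := rfl

/-- [folklore] `rfl` view, run A. -/
@[simp] theorem relPair_fst (R : TowerData (D.F.P (D.K + 1)) o) : (relPair D R).1 = resA D R := rfl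

/-- [folklore] `rfl` view, run B. -/
@[simp] theorem relPair_snd (R : TowerData (D.F.P (D.K + 1)) o) : (relPair D R).2 = R := rfl

omit [Fintype o] [DecidableEq o] in
/-- [folklore] `resA` is additive. -/
theorem resA_add (R S : TowerData (D.F.P (D.K + 1)) o) : resA D (R + S) = resA D R + resA D S := rfl

omit [Fintype o] [DecidableEq o] in
/-- [folklore] `resA` commutes with scalars. -/
theorem resA_smul (c : ℂ) (R : TowerData (D.F.P (D.K + 1)) o) : resA D (c • R) = c • resA D R := rfl

omit [Fintype o] [DecidableEq o] in
/-- [folklore] `resA 0 = 0`. -/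
@[simp] theorem resA_zero : resA D (0 : TowerData (D.F.P (D.K + 1)) o) = 0 := rfl

/-- [folklore] **`resA` DOES NOT INCREASE THE SUP NORM** (it forgets one level). -/
theorem norm_resA_le (A : TowerData (D.F.P (D.K + 1)) o) : ‖resA D A‖ ≤ ‖A‖ := by
  refine (pi_norm_le_iff_of_nonneg (norm_nonneg _)).2 fun k => (pi_norm_le_iff_of_nonneg (norm_nonneg _)).2 fun ν =>
    (pi_norm_le_iff_of_nonneg (norm_nonneg _)).2 fun x => ?_
  rw [resA_apply]
  exact SubstrateChartRealSlice.norm_apply_le_norm (D.F.P (D.K + 1)) A ⟨k.1, lt_levels_succ D k⟩ ν x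

/-- [folklore] `resA` of a unitary tower is unitary. -/
theorem resA_mem_unitaryLev {R : TowerData (D.F.P (D.K + 1)) o} (hR : R ∈ unitaryLev (D.F.P (D.K + 1)) o) : resA D R ∈ unitaryLev (D.F.P D.K) o :=
  fun k ν x => hR ⟨k.1, lt_levels_succ D k⟩ ν x

omit [Fintype o] [DecidableEq o] in
/-- [folklore] `resA` of a levelwise skew-Hermitian coordinate is levelwise skew-Hermitian. -/
theorem resA_mem_skewLev {A : TowerData (D.F.P (D.K + 1)) o} (hA : A ∈ skewLev (D.F.P (D.K + 1)) o) : resA D A ∈ skewLev (D.F.P D.K) o :=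
  fun k ν x => hA ⟨k.1, lt_levels_succ D k⟩ ν x

/-- [folklore] The related pair of a unitary tower lies in the real slice of the pair chart. -/
theorem relPair_mem_unitaryLev₂ {R : TowerData (D.F.P (D.K + 1)) o} (hR : R ∈ unitaryLev (D.F.P (D.K + 1)) o) : relPair D R ∈ unitaryLev₂ D :=
  ⟨resA_mem_unitaryLev D hR, hR⟩

/-- [folklore] **`resA` COMMUTES WITH THE EXPONENTIAL CHART** (both are levelwise). -/
theorem resA_expChartT (R₀ A : TowerData (D.F.P (D.K + 1)) o) : resA D (expChartT _ R₀ A) = expChartT _ (resA D R₀) (resA D A) := rfl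

/-- [folklore] `resA` commutes with the inverse-side chart. -/
theorem resA_expChartInvT (R₀ A : TowerData (D.F.P (D.K + 1)) o) : resA D (expChartInvT _ R₀ A) = expChartInvT _ (resA D R₀) (resA D A) := rfl

omit [Fintype o] [DecidableEq o] in
/-- [folklore] **`resA` COMMUTES WITH THE DISC MAP** `sliceArg` (affine in the splitting). -/
theorem resA_sliceArg (A : TowerData (D.F.P (D.K + 1)) o) (r : ℝ) (z : ℂ) : resA D (sliceArg _ A r z) = sliceArg _ (resA D A) r z := rfl

/-- [folklore] … and with the disc of towers `sliceDisc`. -/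
theorem resA_sliceDisc (R₀ A : TowerData (D.F.P (D.K + 1)) o) (r : ℝ) (z : ℂ) :
    resA D (sliceDisc _ R₀ A r z) = sliceDisc _ (resA D R₀) (resA D A) r z := rfl

/-- [folklore] **THE RELATED PAIR OF A CHART POINT IS THE PAIR POINT AT RELATED CENTRE AND RELATED COORDINATE.** -/
theorem pairPoint_relPair (R₀ A : TowerData (D.F.P (D.K + 1)) o) : pairPoint D (relPair D R₀) (relPair D A) = relPair D (expChartT _ R₀ A) := rfl

/-- [folklore] **THE RELATED PAIR OF A DISC IS THE PAIR DISC AT RELATED CENTRE AND RELATED COORDINATE** (so L-E12∕L-E12b∕L-E12c apply BY NAME). -/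
theorem sliceDisc₂_relPair (R₀ A : TowerData (D.F.P (D.K + 1)) o) (r : ℝ) (z : ℂ) :
    sliceDisc₂ D (relPair D R₀) (relPair D A) r z = relPair D (sliceDisc _ R₀ A r z) := rfl

/-- [folklore] The related coordinate inherits the depth smallness of each radius: `(1 + r⁻¹)‖resA A‖ ≤ (1 + r⁻¹)‖A‖`. -/
theorem depth_resA_le (A : TowerData (D.F.P (D.K + 1)) o) {r : ℝ} (hr : 0 < r) : (1 + r⁻¹) * ‖resA D A‖ ≤ (1 + r⁻¹) * ‖A‖ :=
  mul_le_mul_of_nonneg_left (norm_resA_le D A) (by positivity)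

/-! ## §2 The section of record is a related pair -/

section Ladder

variable (F : T4Family) (K : ℕ)

/-- [folklore] **THE TOWER CHARTS ARE COHERENT ALONG THE LADDER**: reading a V1 site of level `j` of the `K`-th torus in the level-`k` tower chart (`j + k = K`)
and reading its ladder image (level `j + 1` of the `(K+1)`-st torus) in the `(K+1)`-st run's level-`k` chart give the same point of `Tor (fine (lev L k) (2L^m))`
(coordinatewise `ZMod.ringEquivCongr`, compared through `ZMod.val`). -/
theorem siteIdx_ladder {j k : ℕ} (hjA : j + k = (F.P K).K) (hjB : (j + 1) + k = (F.P (K + 1)).K) (y : Site (F.P K) j) :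
    siteIdx (F.P (K + 1)) hjB (siteShift (sitesPerDir_ladder F (rfl : K + 1 = K + 1) (rfl : j + 1 = j + 1)) y) = siteIdx (F.P K) hjA y := by
  funext μ
  show ZMod.ringEquivCongr (sitesPerDir_eq_fine (F.P (K + 1)) hjB μ) (ZMod.ringEquivCongr (sitesPerDir_ladder F rfl rfl) (y μ)) =
    ZMod.ringEquivCongr (sitesPerDir_eq_fine (F.P K) hjA μ) (y μ)
  rw [ZMod.ringEquivCongr_ringEquivCongr_apply]
  rfl

/-- [folklore] The same coherence for the inverse charts. -/
theorem siteIdx_symm_ladder {j k : ℕ} (hjA : j + k = (F.P K).K) (hjB : (j + 1) + k = (F.P (K + 1)).K)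
    (x : Tor (fine (lev (F.P K).L k) (unitMod (F.P K)))) :
    (siteIdx (F.P (K + 1)) hjB).symm x = siteShift (sitesPerDir_ladder F (rfl : K + 1 = K + 1) (rfl : j + 1 = j + 1)) ((siteIdx (F.P K) hjA).symm x) := by
  apply (siteIdx (F.P (K + 1)) hjB).injective
  rw [Equiv.apply_symm_apply, siteIdx_ladder F K hjA hjB, Equiv.apply_symm_apply]

end Ladder

/-- [folklore] **THE TOWER OF RECORD AT A DISPLAYED V1 LEVEL**: with `j + k = K`, level `k` of `towerDataOf P ι av U` reads the `j`-fold average `M^j U` through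
the level-`k` chart (the definition, with the arithmetic `j = K − k` displayed as a hypothesis). -/
theorem towerDataOf_apply_of_eq (P : Params) (ι : G →* Matrix o o ℂ) (av : ∀ j, Averaging P j G) (U : GaugeField P 0 G) (k : Fin (P.K + 1)) {j : ℕ}
    (hj : j + k = P.K) (ν : Fin P.d) (x : Tor (fine (lev P.L k) (unitMod P)) × Fin P.d) :
    towerDataOf P ι av U k ν x = ι (Averaging.iter av j U ⟨(siteIdx P hj).symm x.1, ν⟩) := by
  obtain rfl : j = P.K - k := by omega
  rfl

variable (ι : G →* Matrix o o ℂ)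

/-- [folklore] **RUN A's TOWER OF THE TRANSPORTED FIELD IS RUN B's TOWER WITH THE TOP LEVEL DROPPED**: for every run-B configuration `U`,
`towerDataOf (F.P K) ι avA (transportRaw F K av U) = resA D (towerDataOf (F.P (K+1)) ι avB U)` — `DrivenRuns.iter_transportRaw` level by level + the
ladder coherence of the tower charts. -/
theorem towerDataOf_transport (U : GaugeField (D.F.P (D.K + 1)) 0 G) :
    towerDataOf (D.F.P D.K) ι D.avA (transportRaw D.F D.K D.av U) = resA D (towerDataOf (D.F.P (D.K + 1)) ι D.avB U) := by
  funext k ν x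
  have hk : k.1 ≤ D.K := by have := k.2; simp only [T4Family.P_K] at this; omega
  have hjA : (D.K - k.1) + k.1 = (D.F.P D.K).K := by simp only [T4Family.P_K]; omega
  have hjB : (D.K - k.1 + 1) + k.1 = (D.F.P (D.K + 1)).K := by simp only [T4Family.P_K]; omega
  rw [towerDataOf_apply_of_eq _ _ _ _ _ hjA, resA_apply, towerDataOf_apply_of_eq _ _ _ _ _ hjB, D.iter_transportRaw, ladderShift_eq, fieldShift_apply,
    siteIdx_symm_ladder D.F D.K hjA hjB]
  rfl

/-- [folklore] **THE SECTION OF RECORD IS A RELATED PAIR**: `sectionOfRecord D ι U = relPair D (towerDataOf (F.P (K+1)) ι avB U)` — run A reads the transported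
field, whose tower is run B's tower below the top level. -/
theorem sectionOfRecord_eq_relPair (U : D.carriers.BgB) :
    sectionOfRecord D ι U = relPair D (towerDataOf (D.F.P (D.K + 1)) ι D.avB U.1) :=
  Prod.ext (by rw [sectionOfRecord_fst, TwoRuns.carriers_transport_val]; exact towerDataOf_transport D ι U.1) rfl

/-! ## §3 The real window and the related `hslice` package -/

section Window

variable (P : Params)

/-- [folklore] **THE REAL WINDOW OF THE CHART** at a centre `R⁰` with radius `ϱ`: the towers charted from `R⁰` by a levelwise skew-Hermitian coordinate of
sup norm `≤ ϱ` (unitary when `R⁰` is: `realWindow_subset_unitaryLev`).  The real diameters of the slices live here (`sliceDisc_ofReal_mem_realWindow`). -/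
def realWindow (R₀ : TowerData P o) (ϱ : ℝ) : Set (TowerData P o) := expChartT P R₀ '' (skewLev P o ∩ Metric.closedBall 0 ϱ)

/-- [folklore] The real window grows with the radius. -/
theorem realWindow_mono (R₀ : TowerData P o) {ϱ ϱ' : ℝ} (h : ϱ ≤ ϱ') : realWindow P R₀ ϱ ⊆ realWindow P R₀ ϱ' :=
  Set.image_mono (Set.inter_subset_inter_right _ (Metric.closedBall_subset_closedBall h))

/-- [folklore] At a unitary centre the real window consists of unitary towers. -/
theorem realWindow_subset_unitaryLev {R₀ : TowerData P o} (hR₀ : R₀ ∈ unitaryLev P o) (ϱ : ℝ) : realWindow P R₀ ϱ ⊆ unitaryLev P o := by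
  rintro _ ⟨B, ⟨hB, -⟩, rfl⟩
  exact expChartT_mem_unitaryLev P hR₀ hB

/-- [folklore] The centre lies in its window (`ϱ ≥ 0`, coordinate `0`). -/
theorem self_mem_realWindow (R₀ : TowerData P o) {ϱ : ℝ} (hϱ : 0 ≤ ϱ) : R₀ ∈ realWindow P R₀ ϱ :=
  ⟨0, ⟨fun k ν x => by simp, by simpa using hϱ⟩, expChartT_zero P R₀⟩

/-- [folklore] **THE REAL DIAMETER OF A SLICE LIES IN THE WINDOW OF RADIUS `(1 + r⁻¹)‖A‖`** (`sliceArg_ofReal_mem_skewLev`, `norm_sliceArg_le`). -/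
theorem sliceDisc_ofReal_mem_realWindow (R₀ A : TowerData P o) {r : ℝ} (hr : 0 < r) {x : ℝ} (hx : |x| < 1) {ϱ : ℝ} (hϱ : (1 + r⁻¹) * ‖A‖ ≤ ϱ) :
    sliceDisc P R₀ A r x ∈ realWindow P R₀ ϱ :=
  ⟨sliceArg P A r x, ⟨sliceArg_ofReal_mem_skewLev P A r x,
    mem_closedBall_zero_iff.2 ((norm_sliceArg_le P A hr (by rw [Complex.norm_real, Real.norm_eq_abs]; exact hx.le)).trans hϱ)⟩, rfl⟩

end Window

section Related

variable {R₀ : TowerData (D.F.P (D.K + 1)) o} (hR₀ : R₀ ∈ unitaryLev (D.F.P (D.K + 1)) o)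

/-- [folklore] **THE RELATED `hslice` PACKAGE** (the seven clauses of `OutputRateComplexSlice.operatorRate_complex_of_realSlice_each` ∕ the per-entry `hslice` of
g36-c `OutputRateComplexSliceEntrywise.weightedEntrywiseRate_complex_of_record` at `𝒱 := TwoRunChart D o`, chart point `relPair D (expChartT _ R⁰ A)`): for ANY
run-B centre `R⁰` (unitarity is not needed for these seven clauses), a common depth `0 < r`, a run-A family `FA` analytic and `CA`-bounded on the chart ball of radius `ρA` at the RELATED centre
`resA D R⁰`, a run-B family `FB` analytic and `CB`-bounded on the chart ball of radius `ρB` at `R⁰`, ONE run-B coordinate `A` with `(1 + r⁻¹)‖A‖ < ρA`,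
`(1 + r⁻¹)‖A‖ < ρB`, and any set `W ⊇ realWindow _ R⁰ ((1 + r⁻¹)‖A‖)`: the related slice `γ := relPair D ∘ sliceDisc _ R⁰ A r`, `z₀ := I·r` witness the seven
clauses WITH THE REAL DIAMETER IN `relPair D '' W`. -/
theorem hslice_related_each {EA EB : Type*} [NormedAddCommGroup EA] [NormedSpace ℂ EA] [NormedAddCommGroup EB] [NormedSpace ℂ EB]
    (FA : TowerData (D.F.P D.K) o → EA) (FB : TowerData (D.F.P (D.K + 1)) o → EB) {ρA ρB CA CB r : ℝ} (hr : 0 < r)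
    (hanA : AnalyticOnNhd ℂ (fun B => FA (expChartT _ (resA D R₀) B)) (Metric.ball 0 ρA))
    (hbdA : ∀ B ∈ Metric.ball 0 ρA, ‖FA (expChartT _ (resA D R₀) B)‖ ≤ CA)
    (hanB : AnalyticOnNhd ℂ (fun B => FB (expChartT _ R₀ B)) (Metric.ball 0 ρB))
    (hbdB : ∀ B ∈ Metric.ball 0 ρB, ‖FB (expChartT _ R₀ B)‖ ≤ CB)
    (A : TowerData (D.F.P (D.K + 1)) o) (hA1 : (1 + r⁻¹) * ‖A‖ < ρA) (hA2 : (1 + r⁻¹) * ‖A‖ < ρB)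
    {W : Set (TowerData (D.F.P (D.K + 1)) o)} (hW : realWindow _ R₀ ((1 + r⁻¹) * ‖A‖) ⊆ W) :
    ∃ γ : ℂ → TwoRunChart D o, ∃ z₀ : ℂ, ‖z₀‖ ≤ r ∧ γ z₀ = relPair D (expChartT _ R₀ A) ∧ (∀ x : ℝ, |x| < 1 → γ x ∈ relPair D '' W) ∧
      DiffContOnCl ℂ (fun z => FA (γ z).1) (Metric.ball (0 : ℂ) 1) ∧ DiffContOnCl ℂ (fun z => FB (γ z).2) (Metric.ball (0 : ℂ) 1) ∧
      (∀ z : ℂ, ‖z‖ ≤ 1 → ‖FA (γ z).1‖ ≤ CA) ∧ ∀ z : ℂ, ‖z‖ ≤ 1 → ‖FB (γ z).2‖ ≤ CB :=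
  have hA1' : (1 + r⁻¹) * ‖resA D A‖ < ρA := (depth_resA_le D A hr).trans_lt hA1
  ⟨fun z => relPair D (sliceDisc _ R₀ A r z), I * r, by rw [norm_I_mul_ofReal, abs_of_pos hr],
    by simp only [SubstrateChartRealSlice.sliceDisc_I_mul _ R₀ A hr.ne'],
    fun x hx => Set.mem_image_of_mem _ (hW (sliceDisc_ofReal_mem_realWindow _ R₀ A hr hx le_rfl)),
    diffContOnCl_comp_sliceArg _ (F := fun B => FA (expChartT _ (resA D R₀) B)) hanA (resA D A) hr hA1',
    diffContOnCl_comp_sliceArg _ (F := fun B => FB (expChartT _ R₀ B)) hanB A hr hA2,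
    fun _ hz => norm_comp_sliceArg_le _ (F := fun B => FA (expChartT _ (resA D R₀) B)) hbdA (resA D A) hr hA1' hz,
    fun _ hz => norm_comp_sliceArg_le _ (F := fun B => FB (expChartT _ R₀ B)) hbdB A hr hA2 hz⟩

include hR₀ in
/-- [folklore] **L-E12's THIRD CLAUSE RECOVERED**: the same package with the real diameter in `unitaryLev₂ D` (the related window is unitary) — i.e. literally
`SubstrateChartRealSlicePair.hslice_sliceDisc₂_each`'s conclusion at the related centre `relPair D R⁰` and related coordinate `relPair D A`. -/
theorem hslice_related_each_unitaryLev₂ {EA EB : Type*} [NormedAddCommGroup EA] [NormedSpace ℂ EA] [NormedAddCommGroup EB] [NormedSpace ℂ EB]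
    (FA : TowerData (D.F.P D.K) o → EA) (FB : TowerData (D.F.P (D.K + 1)) o → EB) {ρA ρB CA CB r : ℝ} (hr : 0 < r)
    (hanA : AnalyticOnNhd ℂ (fun B => FA (expChartT _ (resA D R₀) B)) (Metric.ball 0 ρA))
    (hbdA : ∀ B ∈ Metric.ball 0 ρA, ‖FA (expChartT _ (resA D R₀) B)‖ ≤ CA)
    (hanB : AnalyticOnNhd ℂ (fun B => FB (expChartT _ R₀ B)) (Metric.ball 0 ρB))
    (hbdB : ∀ B ∈ Metric.ball 0 ρB, ‖FB (expChartT _ R₀ B)‖ ≤ CB)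
    (A : TowerData (D.F.P (D.K + 1)) o) (hA1 : (1 + r⁻¹) * ‖A‖ < ρA) (hA2 : (1 + r⁻¹) * ‖A‖ < ρB) :
    ∃ γ : ℂ → TwoRunChart D o, ∃ z₀ : ℂ, ‖z₀‖ ≤ r ∧ γ z₀ = pairPoint D (relPair D R₀) (relPair D A) ∧ (∀ x : ℝ, |x| < 1 → γ x ∈ unitaryLev₂ D) ∧
      DiffContOnCl ℂ (fun z => FA (γ z).1) (Metric.ball (0 : ℂ) 1) ∧ DiffContOnCl ℂ (fun z => FB (γ z).2) (Metric.ball (0 : ℂ) 1) ∧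
      (∀ z : ℂ, ‖z‖ ≤ 1 → ‖FA (γ z).1‖ ≤ CA) ∧ ∀ z : ℂ, ‖z‖ ≤ 1 → ‖FB (γ z).2‖ ≤ CB := by
  obtain ⟨γ, z₀, hz₀, hγ, hreal, h⟩ := hslice_related_each D FA FB hr hanA hbdA hanB hbdB A hA1 hA2 subset_rfl
  refine ⟨γ, z₀, hz₀, hγ, fun x hx => ?_, h⟩
  obtain ⟨R, hR, hRx⟩ := hreal x hx
  rw [← hRx]
  exact relPair_mem_unitaryLev₂ D (realWindow_subset_unitaryLev _ hR₀ _ hR)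

end Related

section Record

variable (ι : G →* Matrix o o ℂ)

/-- [folklore] **THE REAL WINDOW OF RECORD** of radius `ϱ`: the union over run B's admissible backgrounds `U` of the real windows at run B's towers of record
`towerDataOf (F.P (K+1)) ι avB U` — the run-B towers within chart distance `ϱ` (skew-Hermitian coordinates) of SOME tower of record.  Its related image
`relPair D '' realWindowOfRecord D ι ϱ` is the candidate `real` of g36-c ∕ g36-a at the instance (`ρ := relPair D ∘ Subtype.val`), containing the section
of record (`sectionOfRecord_mem_relPair_image_realWindowOfRecord`) and the real diameters of all related slices of depth `≤ ϱ∕(1 + r⁻¹)`. -/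
def realWindowOfRecord (ϱ : ℝ) : Set (TowerData (D.F.P (D.K + 1)) o) :=
  ⋃ U : D.carriers.BgB, realWindow (D.F.P (D.K + 1)) (towerDataOf (D.F.P (D.K + 1)) ι D.avB U.1) ϱ

/-- [folklore] Each background's window lies in the window of record. -/
theorem realWindow_subset_realWindowOfRecord (U : D.carriers.BgB) (ϱ : ℝ) :
    realWindow (D.F.P (D.K + 1)) (towerDataOf (D.F.P (D.K + 1)) ι D.avB U.1) ϱ ⊆ realWindowOfRecord D ι ϱ :=
  Set.subset_iUnion (fun U : D.carriers.BgB => realWindow (D.F.P (D.K + 1)) (towerDataOf (D.F.P (D.K + 1)) ι D.avB U.1) ϱ) U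

/-- [folklore] The window of record consists of unitary towers (unitary `ι`). -/
theorem realWindowOfRecord_subset_unitaryLev (hι : ∀ g, ι g ∈ Matrix.unitaryGroup o ℂ) (ϱ : ℝ) :
    realWindowOfRecord D ι ϱ ⊆ unitaryLev (D.F.P (D.K + 1)) o :=
  Set.iUnion_subset fun U => realWindow_subset_unitaryLev _ (towerDataOf_mem_unitaryLev _ ι D.avB hι U.1) ϱ

/-- [folklore] `Set.range` form of the candidate reading `ρ := relPair D ∘ Subtype.val` on a window `S` (g36-c's `real := Set.range ρ`): `Set.range ρ = relPair D '' S`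
(rewrite the third clause of `hslice_related_each` ∕ `_record` with it, `S := W` ∕ `realWindowOfRecord D ι ϱ`). -/
theorem range_relPair_restrict (S : Set (TowerData (D.F.P (D.K + 1)) o)) : Set.range (fun w : S => relPair D w.1) = relPair D '' S :=
  (Set.image_eq_range _ _).symm

/-- [folklore] **THE SECTION OF RECORD LIES IN THE RELATED IMAGE OF THE WINDOW OF RECORD** (`ϱ ≥ 0`; by §2 and `self_mem_realWindow`). -/
theorem sectionOfRecord_mem_relPair_image_realWindowOfRecord (U : D.carriers.BgB) {ϱ : ℝ} (hϱ : 0 ≤ ϱ) :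
    sectionOfRecord D ι U ∈ relPair D '' realWindowOfRecord D ι ϱ := by
  rw [sectionOfRecord_eq_relPair]
  exact Set.mem_image_of_mem _ (realWindow_subset_realWindowOfRecord D ι U ϱ (self_mem_realWindow _ _ hϱ))

/-- [folklore] **THE RELATED `hslice` PACKAGE AT A BACKGROUND OF RECORD**: centre := run B's tower of record of `U`, run A's centre REWRITTEN to
`(sectionOfRecord D ι U).1` by §2 (so the W-17b∕W-17c `_sectionOfRecord` species letters supply `hanA`∕`hbdA` verbatim), any depth `ϱ ≥ (1 + r⁻¹)‖A‖`: the
seven clauses at the chart point `relPair D (expChartT _ (towerDataOf _ ι avB U) A)` with the real diameter in `relPair D '' realWindowOfRecord D ι ϱ`. -/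
theorem hslice_related_each_record (U : D.carriers.BgB)
    {EA EB : Type*} [NormedAddCommGroup EA] [NormedSpace ℂ EA] [NormedAddCommGroup EB] [NormedSpace ℂ EB]
    (FA : TowerData (D.F.P D.K) o → EA) (FB : TowerData (D.F.P (D.K + 1)) o → EB) {ρA ρB CA CB r ϱ : ℝ} (hr : 0 < r)
    (hanA : AnalyticOnNhd ℂ (fun B => FA (expChartT _ (sectionOfRecord D ι U).1 B)) (Metric.ball 0 ρA))
    (hbdA : ∀ B ∈ Metric.ball 0 ρA, ‖FA (expChartT _ (sectionOfRecord D ι U).1 B)‖ ≤ CA)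
    (hanB : AnalyticOnNhd ℂ (fun B => FB (expChartT _ (towerDataOf (D.F.P (D.K + 1)) ι D.avB U.1) B)) (Metric.ball 0 ρB))
    (hbdB : ∀ B ∈ Metric.ball 0 ρB, ‖FB (expChartT _ (towerDataOf (D.F.P (D.K + 1)) ι D.avB U.1) B)‖ ≤ CB)
    (A : TowerData (D.F.P (D.K + 1)) o) (hA1 : (1 + r⁻¹) * ‖A‖ < ρA) (hA2 : (1 + r⁻¹) * ‖A‖ < ρB) (hϱ : (1 + r⁻¹) * ‖A‖ ≤ ϱ) :
    ∃ γ : ℂ → TwoRunChart D o, ∃ z₀ : ℂ, ‖z₀‖ ≤ r ∧ γ z₀ = relPair D (expChartT _ (towerDataOf (D.F.P (D.K + 1)) ι D.avB U.1) A) ∧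
      (∀ x : ℝ, |x| < 1 → γ x ∈ relPair D '' realWindowOfRecord D ι ϱ) ∧
      DiffContOnCl ℂ (fun z => FA (γ z).1) (Metric.ball (0 : ℂ) 1) ∧ DiffContOnCl ℂ (fun z => FB (γ z).2) (Metric.ball (0 : ℂ) 1) ∧
      (∀ z : ℂ, ‖z‖ ≤ 1 → ‖FA (γ z).1‖ ≤ CA) ∧ ∀ z : ℂ, ‖z‖ ≤ 1 → ‖FB (γ z).2‖ ≤ CB := by
  have hc : (sectionOfRecord D ι U).1 = resA D (towerDataOf (D.F.P (D.K + 1)) ι D.avB U.1) := by rw [sectionOfRecord_eq_relPair]; rfl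
  rw [hc] at hanA hbdA
  exact hslice_related_each D FA FB hr hanA hbdA hanB hbdB A hA1 hA2
    ((realWindow_mono _ _ hϱ).trans (realWindow_subset_realWindowOfRecord D ι U ϱ))

end Record

/-! ## §4 The species of record on related data -/

/-- [folklore] **ON RELATED DATA THE TWO RUNS' LEVEL-`k` COVARIANCE SPECIES COINCIDE** (`k ≤ K`, EQUAL letter families `cL aL Γ s`): an identity of the
TYPING OF RECORD (R42: the species are indexed by the common unit torus and the level; both runs' level-`k` species are the same function of the same
level-`k` transporter field on the same fine torus).  It says NOTHING about the content of W1 at the instance — there the letter families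
`(s_A, Γ_A, a′_A)` vs `(s_B, Γ_B, a′_B)` differ and run B's level `K + 1` has no run-A partner (`covAtTLev_resA_top`); Q-NE23-W is the owner's ∕ rows'.  Print
caveat (typer A-S17 (a′)): print's averaging constants carry a STEP index (`a_{K−k}` vs `a_{K+1−k}`, [Balaban1982Higgs1] (2.22)); the model's `aPr` has none. -/
theorem covAtTLev_resA (cL : ℕ → ℂ) (aL : ℕ → ℝ) (s : ℕ → ℂ)
    (Γ : (k : ℕ) → ContourSystem (D.F.P (D.K + 1)).d (lev (D.F.P (D.K + 1)).L k) (unitMod (D.F.P (D.K + 1))))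
    (R S : TowerData (D.F.P (D.K + 1)) o) {k : ℕ} (hk : k ≤ D.K) {T : Type*} (t : T)
    (b b' : (Tor (unitMod (D.F.P (D.K + 1))) × Fin (D.F.P (D.K + 1)).d) × o) :
    covAtTLev (D.F.P D.K) cL aL Γ s (resA D R) (resA D S) k t b b' = covAtTLev (D.F.P (D.K + 1)) cL aL Γ s R S k t b b' := by
  rw [covAtTLev_apply, covAtTLev_apply]
  unfold covAtT
  rw [dif_pos (show k ≤ (D.F.P D.K).K from hk), dif_pos (show k ≤ (D.F.P (D.K + 1)).K from Nat.le_succ_of_le hk)]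
  rfl

/-- [folklore] Above run A's top level run A's species reads `0` (levels `k > K`; in particular at run B's top level `K + 1`). -/
theorem covAtTLev_resA_top (cL : ℕ → ℂ) (aL : ℕ → ℝ) (s : ℕ → ℂ)
    (Γ : (k : ℕ) → ContourSystem (D.F.P D.K).d (lev (D.F.P D.K).L k) (unitMod (D.F.P D.K)))
    (R S : TowerData (D.F.P D.K) o) {k : ℕ} (hk : D.K < k) {T : Type*} (t : T) (b b' : (Tor (unitMod (D.F.P D.K)) × Fin (D.F.P D.K).d) × o) :
    covAtTLev (D.F.P D.K) cL aL Γ s R S k t b b' = 0 := by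
  rw [covAtTLev_apply]
  unfold covAtT
  rw [dif_neg (show ¬ k ≤ (D.F.P D.K).K from Nat.not_le.2 hk)]

/-- [folklore] **AT THE RECORD: RUN A's COVARIANCE SPECIES OF RECORD AT THE TRANSPORTED FIELD = RUN B's AT THE FIELD** (levels `k ≤ K`), for ONE scalar letter
triple `(c, a, s)` — `SubstrateSlotsOfRecord.slotsOfRecord` feeds the SAME `(c, a, s)` to `rawAOfRecord` and `rawBOfRecord` — and ONE contour-system family `Γ`
serving both runs at aligned levels (the runs' level-`k` contour-system types agree).  `covAtOfRecord_eq_covAtT` + `towerDataOf_transport` + `rfl`.  Typing-of-record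
identity (Q-S17, covariance species); whether the instance's `ΓA k` and `ΓB k` coincide and what the non-covariance tables `dk ∕ gc ∕ pQ ∕ pR` do is NOT said here. -/
theorem covAtOfRecord_transport (c : ℂ) (a : ℝ) (s : ℕ → ℂ)
    (Γ : (k : ℕ) → ContourSystem (D.F.P (D.K + 1)).d (lev (D.F.P (D.K + 1)).L k) (unitMod (D.F.P (D.K + 1)))) (U : GaugeField (D.F.P (D.K + 1)) 0 G)
    {k : ℕ} (hk : k ≤ D.K) {T : Type*} (t : T) (b b' : (Tor (unitMod (D.F.P (D.K + 1))) × Fin (D.F.P (D.K + 1)).d) × o) :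
    SubstrateRawSpecies.covAtOfRecord (D.F.P D.K) ι D.avA c a s Γ (transportRaw D.F D.K D.av U) k t b b' =
      SubstrateRawSpecies.covAtOfRecord (D.F.P (D.K + 1)) ι D.avB c a s Γ U k t b b' := by
  rw [covAtOfRecord_eq_covAtT, covAtOfRecord_eq_covAtT, towerDataOf_transport]
  unfold covAtT
  rw [dif_pos (show k ≤ (D.F.P D.K).K from hk), dif_pos (show k ≤ (D.F.P (D.K + 1)).K from Nat.le_succ_of_le hk)]
  rfl

/-- [folklore] … on the carriers of record: for `U : D.carriers.BgB`, run A's covariance of record at `D.carriers.transport U` = run B's at `U` (levels `≤ K`). -/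
theorem covAtOfRecord_carriers_transport (c : ℂ) (a : ℝ) (s : ℕ → ℂ)
    (Γ : (k : ℕ) → ContourSystem (D.F.P (D.K + 1)).d (lev (D.F.P (D.K + 1)).L k) (unitMod (D.F.P (D.K + 1)))) (U : D.carriers.BgB)
    {k : ℕ} (hk : k ≤ D.K) {T : Type*} (t : T) (b b' : (Tor (unitMod (D.F.P (D.K + 1))) × Fin (D.F.P (D.K + 1)).d) × o) :
    SubstrateRawSpecies.covAtOfRecord (D.F.P D.K) ι D.avA c a s Γ (D.carriers.transport U).1 k t b b' =
      SubstrateRawSpecies.covAtOfRecord (D.F.P (D.K + 1)) ι D.avB c a s Γ U.1 k t b b' := by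
  rw [TwoRuns.carriers_transport_val]; exact covAtOfRecord_transport D ι c a s Γ U.1 hk t b b'

end Summit.QuantumFields.BalabanUV.T4Continuum.SubstrateChartRelatedPair

end
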